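import Literature.AlgebraicGeometry.HodgeTheory.CorrespondenceActionOfGraph
import Literature.AlgebraicGeometry.HodgeTheory.ComplexGysinHodgeType
import Literature.AlgebraicGeometry.HodgeTheory.HodgeFiltrationModelsReductionProofs
import Literature.AlgebraicGeometry.HodgeTheory.ComplexConjugationHolds
import Literature.AlgebraicGeometry.HodgeTheory.ArapuraSurfaceFibredFourfoldsProofs
import Literature.NumberTheory.Transcendental.DeRhamTheoremMultiplicative
import Summits.HodgeConjecture.HodgeConjecture.Theorems.NikulinTwinTransportSquareGlueHodge

/-!
# Crux `TwinTransportRMPicardTwo` (stmt-HodgeConjecture-15067), line `Sketch` — stub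
# `stub_pushPull_spec`: push–pull operators `c • f₊ g^* + c • f₊ g'^*` through a smooth projective
# surface

Helper file (`--supports stmt-HodgeConjecture-15067`) for the line `Sketch` (dihedral Hecke octagon)
of the crux `Summit.HodgeConjecture.HodgeConjecture.Theses.NikulinTwinTransport.TwinTransportRMPicardTwo`.
For smooth projective complex surfaces `S`, `W`, morphisms `f g g' : W ⟶ S`, a scalar `c` and the
operator `T x = c • f₊ (g^* x) + c • f₊ (g'^* x)` on `H²(S(ℂ); ℂ)` (Gysin morphisms `complexGysin μ` of
an orientation family `μ` with Poincaré duality, pull-backs `complexBetti.map`):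

* `T` is the action `[γ]_* = pr₁₊(pr₂^* (–) ∪ γ)` of an ALGEBRAIC self-correspondence
  `γ ∈ N² H⁴((S ⊗ S)(ℂ); ℂ)`, namely `γ = c • (f, g)₊ 1 + c • (f, g')₊ 1` (Fulton, *Intersection
  Theory* §16.1: the graph class `(f, g)_*[W]` acts by `f_* g^*`; the tree's
  `exists_algebraic_corrAction_eq_of_pushPull`, `corrAction_apply`);
* `T` preserves every Hodge type `(i, j)`: pull-backs preserve types
  (`IsOfHodgeType.map_of_independent`) and the Gysin morphism of `f : W ⟶ S`, of relative dimension
  `0`, has bidegree `(0, 0)` (Voisin I §7.3.2; the tree's `isOfHodgeType_complexGysin`, fed with the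
  proved facts `hodgePQ_independent_of_hodgeModel_holds`, `nonempty_hodgeModel_holds`,
  `exists_deRhamIsoFamily_holds`);
* `T` maps the Néron–Severi classes `N¹ H² = algebraicClasses S 1` into themselves, granted that
  `g`, `g'` are surjective whenever `f` is: if `f` is NOT surjective, `f₊` pushes every class into
  `N¹` (its image is a proper closed subset; `complexGysin_mem_supportedClasses_one_of_not_surjective`);
  if it is, `g^* N¹H²(S) ⊆ N¹H²(W)` for surjective `g` (`map_mem_algebraicClasses_one_of_surjective`)
  and `f₊ N¹H²(W) ⊆ N¹H²(S)` for every `f` (`complexGysin_mem_algebraicClasses`, proper push-forward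
  with the proved support property `gysinMap_restrictCompl_eq_zero_of_field ℂ`);
* `T` preserves rational classes as soon as `c • f₊` does (`IsRationalClass.map`, `.add`).

The surjectivity proviso in the third item is where the tree stands: pull-back of `N¹` along a
NON-surjective `g : W ⟶ S` whose image is a curve `C` (a class supported on `C` pulls back to a
multiple of a fibre class) needs purity `H²_C(S) = ℂ · cl(C)` or Lefschetz `(1,1)` for `W`, neither of
which is a theorem of the tree (`PulledBackAlgebraicClasses`, module docstring: pull-back of
algebraic classes is kept as a hypothesis; `lefschetzOneOne_rational`,
`Deligne1974_ker_restrictCompl_eq_iSup_range_complexGysin` are named facts). In the line's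
composition `f = π`, `g = σ ≫ π`, `g' = σ' ≫ π` for automorphisms `σ`, `σ'` of the cover
`π : W ⟶ S` inverse to each other, and the proviso HOLDS unconditionally
(`surjective_left_base_comp_of_inverse`).

## References

* [Fulton1998] W. Fulton, *Intersection Theory*, 2nd ed., Springer 1998, §16.1 Prop. 16.1.1,
  Def. 16.1.2.
* [VoisinHodgeI2002] C. Voisin, *Hodge Theory and Complex Algebraic Geometry I*, CUP 2002, §7.3.2,
  Lemma 7.30, §11.1.2.
* [FultonYoungTableaux1997] W. Fulton, *Young Tableaux*, CUP 1997, Appendix B §B.1 (5)–(6), §B.2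
  Exercise 5.
* [Arapura2022] D. Arapura, proof of Cor. 1.5 (pull-back of `N¹` along surjections).
-/

noncomputable section

set_option linter.dupNamespace false

namespace Summit.HodgeConjecture.HodgeConjecture.Theorems.NikulinTwinTransport

open scoped Manifold
open CategoryTheory MonoidalCategory SemiCartesianMonoidalCategory CartesianMonoidalCategory
open Literature.AlgebraicGeometry.Motives Literature.AlgebraicGeometry.HodgeTheory
open Literature.AlgebraicTopology.SingularHomology

section PushPull

variable {μ : OrientationFamily} {m n : ℕ} {S W : SchemeOver ℂ}

/-- **A sum of two push–pull operators `c • f₊ g^* + c • f₊ g'^*` through a smooth projective `W`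
of the same dimension as `S` is the action of an algebraic self-correspondence of `S`**:
`γ = c • (f, g)₊ 1 + c • (f, g')₊ 1 ∈ Nⁿ H²ⁿ((S ⊗ S)(ℂ); ℂ)` and `[γ]_* = corrAction μ hS hS rfl γ`
is the given operator (`exists_algebraic_corrAction_eq_of_pushPull` twice, linearity of `[–]_*` in
the class). [cite: Fulton1998, §16.1 Prop. 16.1.1 and Def. 16.1.2] -/
theorem exists_algebraic_corrAction_eq_pushPull_add (hμ : μ.HasPoincareDuality)
    (hS : IsSmoothProjective n S) (hW : IsSmoothProjective n W) (f g g' : W ⟶ S) (c : ℂ) {a : ℕ} :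
    ∃ γ ∈ algebraicClasses (S ⊗ S) n,
      corrAction μ hS hS (rfl : a + 2 * n = a + 2 * n) γ =
        c • (complexGysin μ hW hS f (rfl : a + 2 * n = a + 2 * n) ∘ₗ (complexBetti.map g a).hom) +
          c • (complexGysin μ hW hS f (rfl : a + 2 * n = a + 2 * n) ∘ₗ
            (complexBetti.map g' a).hom) := by
  obtain ⟨γ, hγ, h⟩ := exists_algebraic_corrAction_eq_of_pushPull (μ := μ) hμ hS
    (T := c • (complexGysin μ hW hS f (rfl : a + 2 * n = a + 2 * n) ∘ₗ (complexBetti.map g a).hom))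
    ⟨W, hW, f, g, c, rfl⟩
  obtain ⟨γ', hγ', h'⟩ := exists_algebraic_corrAction_eq_of_pushPull (μ := μ) hμ hS
    (T := c • (complexGysin μ hW hS f (rfl : a + 2 * n = a + 2 * n) ∘ₗ (complexBetti.map g' a).hom))
    ⟨W, hW, f, g', c, rfl⟩
  exact ⟨γ + γ', Submodule.add_mem _ hγ hγ', by rw [map_add, h, h']⟩

/-- **One push–pull term preserves Hodge types up to the relative dimension**: for `f g : W ⟶ S`
(`dim W = m`, `dim S = n`) and `x ∈ Hᵃ(S(ℂ); ℂ)` of type `(i, j)`, `f₊ (g^* x) ∈ Hᵇ(S(ℂ); ℂ)` is of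
type `(i', j')`, `i' + m = i + n`, `j' + m = j + n` — pull-backs preserve types
(`IsOfHodgeType.map_of_independent`) and Gysin morphisms shift them by the relative dimension
(`isOfHodgeType_complexGysin`), from the proved facts `hodgePQ_independent_of_hodgeModel_holds`,
`nonempty_hodgeModel_holds` and de Rham. [cite: VoisinHodgeI2002, §7.3.2 (with Lemma 7.30)] -/
theorem isOfHodgeType_complexGysin_map (μ : OrientationFamily) (hS : IsSmoothProjective n S)
    (hW : IsSmoothProjective m W) (f g : W ⟶ S) {a b : ℕ} (hab : a + 2 * n = b + 2 * m)
    {i j i' j' : ℕ} (hi : i' + m = i + n) (hj : j' + m = j + n) {x : complexBetti S a}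
    (hx : IsOfHodgeType n S a i j x) :
    IsOfHodgeType n S b i' j' (complexGysin μ hW hS f hab (complexBetti.map g a x)) :=
  isOfHodgeType_complexGysin hodgePQ_independent_of_hodgeModel_holds
    (fun _ _ => nonempty_hodgeModel_holds)
    (fun E _ _ _ => Literature.NumberTheory.Transcendental.exists_deRhamIsoFamily_holds E) μ hW hS f
    hab hi hj
    (hx.map_of_independent hodgePQ_independent_of_hodgeModel_holds hW hS
      (nonempty_hodgeModel_holds.nonempty hW).some g)

/-- **A non-surjective morphism pushes every class into `N¹`**: for `f : W ⟶ S` between smooth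
projective varieties with `f` not surjective on points, the image `f(W)` is a proper Zariski-closed
subset (`f` is proper, hence closed), so of codimension `≥ 1` in the irreducible `S`
(`one_le_coheight_of_mem_of_isClosed`), and `f₊ y` dies off `f(W)` for every `y`
(`complexGysin_restrictCompl_eq_zero` with the proved support property
`gysinMap_restrictCompl_eq_zero_of_field ℂ`: `y` dies off `f⁻¹(f(W)) = W` vacuously, the complement
having no complex points). [cite: FultonYoungTableaux1997, Appendix B §B.2 Exercise 5]
[cite: GrothendieckTopology1969, §1] -/
theorem complexGysin_mem_supportedClasses_one_of_not_surjective (hμ : μ.HasPoincareDuality)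
    (hW : IsSmoothProjective m W) (hS : IsSmoothProjective n S) (f : W ⟶ S)
    (hf : ¬ Function.Surjective f.left.base) {a b : ℕ} (hab : a + 2 * n = b + 2 * m)
    (y : complexBetti W a) : complexGysin μ hW hS f hab y ∈ supportedClasses S b 1 := by
  have hfc : IsClosedMap f.left.base :=
    haveI := isProper_left_of_isSmoothProjective hW hS f
    f.left.isClosedMap
  have hZ : IsClosed (Set.range f.left.base) := hfc.isClosed_range
  have hZne : Set.range f.left.base ≠ Set.univ := fun h => hf (Set.range_eq_univ.1 h)
  refine mem_supportedClasses_of_restrictCompl_eq_zero hZ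
    (fun z hz => by exact_mod_cast one_le_coheight_of_mem_of_isClosed hS hZ hZne hz) ?_
  refine complexGysin_restrictCompl_eq_zero (gysinMap_restrictCompl_eq_zero_of_field ℂ) μ hμ hW hS f
    hab hZ y ?_
  haveI : IsEmpty (complexPointsCompl W (f.left.base ⁻¹' Set.range f.left.base)) :=
    ⟨fun P => P.2 ⟨P.1.pt, rfl⟩⟩
  haveI := ModuleCat.subsingleton_of_isZero
    (isZero_singularCohomology_of_isEmpty ℂ ℂ
      (E := complexPointsCompl W (f.left.base ⁻¹' Set.range f.left.base)) a)
  exact Subsingleton.elim _ _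

/-- **One push–pull term maps Néron–Severi classes to Néron–Severi classes**, granted that `g` is
surjective whenever `f` is: for `f g : W ⟶ S` between smooth projective varieties of the same
dimension and `x ∈ N¹H²(S(ℂ); ℂ) = algebraicClasses S 1`, `f₊ (g^* x) ∈ algebraicClasses S 1` — if
`f` is not surjective every `f₊ y` lies in `N¹`
(`complexGysin_mem_supportedClasses_one_of_not_surjective`); if it is, `g` is surjective, `g^*`
preserves `N¹` along surjections (`map_mem_algebraicClasses_one_of_surjective`) and the proper
push-forward `f₊` preserves the coniveau in relative dimension `0`
(`complexGysin_mem_algebraicClasses`).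
[cite: FultonYoungTableaux1997, Appendix B §B.2 Exercise 5] [cite: Arapura2022, proof of Cor. 1.5 (p. 5)] -/
theorem complexGysin_map_mem_algebraicClasses_one (hμ : μ.HasPoincareDuality)
    (hS : IsSmoothProjective n S) (hW : IsSmoothProjective n W) (f g : W ⟶ S)
    (hg : Function.Surjective f.left.base → Function.Surjective g.left.base)
    (hab : 2 * 1 + 2 * n = 2 * 1 + 2 * n) {x : complexBetti S (2 * 1)}
    (hx : x ∈ algebraicClasses S 1) :
    complexGysin μ hW hS f hab (complexBetti.map g (2 * 1) x) ∈ algebraicClasses S 1 := by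
  by_cases hf : Function.Surjective f.left.base
  · exact complexGysin_mem_algebraicClasses (gysinMap_restrictCompl_eq_zero_of_field ℂ) μ hμ hW hS f
      rfl hab (map_mem_algebraicClasses_one_of_surjective hW hS g (hg hf) hx)
  · exact complexGysin_mem_supportedClasses_one_of_not_surjective hμ hW hS f hf hab _

/-- **One push–pull term preserves rational classes once `c • f₊` does**: `g^* x` is rational for
rational `x` (`IsRationalClass.map`). [cite: VoisinHodgeI2002, §7.3.2 and §11.1.2] -/
theorem isRationalClass_smul_complexGysin_map (μ : OrientationFamily) (hS : IsSmoothProjective n S)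
    (hW : IsSmoothProjective m W) (f g : W ⟶ S) {a b : ℕ} (hab : a + 2 * n = b + 2 * m) (c : ℂ)
    (hc : ∀ y : complexBetti W a, IsRationalClass y → IsRationalClass (c • complexGysin μ hW hS f hab y))
    {x : complexBetti S a} (hx : IsRationalClass x) :
    IsRationalClass (c • complexGysin μ hW hS f hab (complexBetti.map g a x)) :=
  hc _ (hx.map (AlgPoints.mapContinuous (L := ℂ) g))

/-- **Surjectivity of a composite of `ℂ`-morphisms on points** (`(σ ≫ π)(P) = π(σ(P))`): used by
the line's composition with `σ` an automorphism of the cover `π : W ⟶ S`.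
[cite: Hartshorne1977, II §3 (morphisms of schemes)] -/
theorem surjective_left_base_comp {W' : SchemeOver ℂ} (σ : W' ⟶ W) (π : W ⟶ S)
    (hσ : Function.Surjective σ.left.base) (hπ : Function.Surjective π.left.base) :
    Function.Surjective (σ ≫ π).left.base := by
  intro P
  obtain ⟨Q, rfl⟩ := hπ P
  obtain ⟨R, rfl⟩ := hσ Q
  exact ⟨R, by simp⟩

/-- **A morphism with a right inverse is surjective on points**: `σ' ≫ σ = 𝟙 W` gives
`σ(σ'(P)) = P`. [cite: Hartshorne1977, II §3 (morphisms of schemes)] -/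
theorem surjective_left_base_of_retraction (σ σ' : W ⟶ W) (h : σ' ≫ σ = 𝟙 W) :
    Function.Surjective σ.left.base := by
  intro P
  refine ⟨σ'.left.base P, ?_⟩
  have h' := congrArg (fun φ : W ⟶ W => φ.left.base P) h
  simpa using h'

/-- **The surjectivity proviso in the line's composition**: for the cover `π : W ⟶ S` and
automorphisms `σ`, `σ'` of `W` inverse to each other, `σ ≫ π` and `σ' ≫ π` are surjective on points
as soon as `π` is — the hypothesis of the Néron–Severi clause of `stub_pushPull_spec` at `f := π`,
`g := σ ≫ π`, `g' := σ' ≫ π`. [cite: Hartshorne1977, II §3 (morphisms of schemes)] -/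
theorem surjective_left_base_comp_of_inverse (π : W ⟶ S) (σ σ' : W ⟶ W) (hσσ' : σ ≫ σ' = 𝟙 W)
    (hσ'σ : σ' ≫ σ = 𝟙 W) :
    Function.Surjective π.left.base →
      Function.Surjective (σ ≫ π).left.base ∧ Function.Surjective (σ' ≫ π).left.base :=
  fun hπ => ⟨surjective_left_base_comp σ π (surjective_left_base_of_retraction σ σ' hσ'σ) hπ,
    surjective_left_base_comp σ' π (surjective_left_base_of_retraction σ' σ hσσ') hπ⟩

end PushPull

/-- **Stub `stub_pushPull_spec` of the line `Sketch` (push–pull operators).** For smooth projective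
surfaces `S`, `W`, morphisms `f g g' : W ⟶ S`, a scalar `c` and the operator
`T x = c • f₊ (g^* x) + c • f₊ (g'^* x)` on `H²(S(ℂ); ℂ)`: `T` is the action
`x ↦ pr₁₊(pr₂^* x ∪ γ)` of an algebraic self-correspondence `γ ∈ N²H⁴((S ⊗ S)(ℂ); ℂ)` of `S` (the
graph classes `c • (f, g)₊ 1 + c • (f, g')₊ 1`, Fulton §16.1), preserves every Hodge type `(i, j)`
(Gysin of relative dimension `0` and pull-backs, Voisin I §7.3.2), maps `N¹ = algebraicClasses S 1`
into itself granted that `g`, `g'` are surjective whenever `f` is (a non-surjective `f` pushes every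
class into `N¹`; pull-back of `N¹` along surjections; proper push-forward), and preserves rational
classes as soon as `c • f₊` does.
[cite: Fulton1998, §16.1 Prop. 16.1.1 and Def. 16.1.2] [cite: VoisinHodgeI2002, §7.3.2 and §11.1.2] -/
theorem stub_pushPull_spec : ∀ (μ : OrientationFamily), μ.HasPoincareDuality →
    ∀ (S W : SchemeOver ℂ) (hS : IsSmoothProjective 2 S) (hW : IsSmoothProjective 2 W)
      (f g g' : W ⟶ S) (c : ℂ) (T : complexBetti S (2 * 1) →ₗ[ℂ] complexBetti S (2 * 1)),
      (∀ x : complexBetti S (2 * 1), T x =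
          c • complexGysin μ hW hS f (rfl : 2 * 1 + 2 * 2 = 2 * 1 + 2 * 2)
                (complexBetti.map g (2 * 1) x) +
            c • complexGysin μ hW hS f (rfl : 2 * 1 + 2 * 2 = 2 * 1 + 2 * 2)
                (complexBetti.map g' (2 * 1) x)) →
      (∃ γ ∈ algebraicClasses (S ⊗ S) 2, ∀ x : complexBetti S (2 * 1), T x =
          complexGysin μ (IsSmoothProjective.tensor_holds hS hS) hS (fst S S)
            (rfl : 2 * 1 + 2 * 2 + 2 * 2 = 2 * 1 + 2 * (2 + 2))
            (cupProduct (rfl : 2 * 1 + 2 * 2 = 2 * 1 + 2 * 2)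
              (complexBetti.map (snd S S) (2 * 1) x) γ)) ∧
      (∀ (i j : ℕ) (x : complexBetti S (2 * 1)), IsOfHodgeType 2 S (2 * 1) i j x →
          IsOfHodgeType 2 S (2 * 1) i j (T x)) ∧
      ((Function.Surjective f.left.base →
          Function.Surjective g.left.base ∧ Function.Surjective g'.left.base) →
        ∀ x ∈ algebraicClasses S 1, T x ∈ algebraicClasses S 1) ∧
      ((∀ y : complexBetti W (2 * 1), IsRationalClass y →
          IsRationalClass (c • complexGysin μ hW hS f (rfl : 2 * 1 + 2 * 2 = 2 * 1 + 2 * 2) y)) →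
        ∀ x : complexBetti S (2 * 1), IsRationalClass x → IsRationalClass (T x)) := by
  intro μ hμ S W hS hW f g g' c T hT
  have hI := hodgePQ_independent_of_hodgeModel_holds
  -- `T` as a linear combination of the two push–pull operators
  have hTeq : T =
      c • (complexGysin μ hW hS f (rfl : 2 * 1 + 2 * 2 = 2 * 1 + 2 * 2) ∘ₗ
          (complexBetti.map g (2 * 1)).hom) +
        c • (complexGysin μ hW hS f (rfl : 2 * 1 + 2 * 2 = 2 * 1 + 2 * 2) ∘ₗ
          (complexBetti.map g' (2 * 1)).hom) :=
    LinearMap.ext fun x => by rw [hT]; rfl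
  refine ⟨?_, fun i j x hx => ?_, fun hgg' x hx => ?_, fun hc x hx => ?_⟩
  · -- the algebraic self-correspondence `γ = c • (f, g)₊ 1 + c • (f, g')₊ 1`
    obtain ⟨γ, hγ, h⟩ := exists_algebraic_corrAction_eq_pushPull_add hμ hS hW f g g' c (a := 2 * 1)
    refine ⟨γ, hγ, fun x => ?_⟩
    have hx : T x = corrAction μ hS hS (rfl : 2 * 1 + 2 * 2 = 2 * 1 + 2 * 2) γ x := by rw [h, hTeq]
    rw [hx]
    exact corrAction_apply μ hS hS (rfl : 2 * 1 + 2 * 2 = 2 * 1 + 2 * 2) γ x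
  · -- Hodge types
    rw [hT]
    exact isOfHodgeType_add' hI hS
      (isOfHodgeType_smul' (isOfHodgeType_complexGysin_map μ hS hW f g _ rfl rfl hx) c)
      (isOfHodgeType_smul' (isOfHodgeType_complexGysin_map μ hS hW f g' _ rfl rfl hx) c)
  · -- Néron–Severi classes
    rw [hT]
    exact Submodule.add_mem _
      (Submodule.smul_mem _ c
        (complexGysin_map_mem_algebraicClasses_one hμ hS hW f g (fun hf => (hgg' hf).1) _ hx))
      (Submodule.smul_mem _ c
        (complexGysin_map_mem_algebraicClasses_one hμ hS hW f g' (fun hf => (hgg' hf).2) _ hx))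
  · -- rational classes
    rw [hT]
    exact (isRationalClass_smul_complexGysin_map μ hS hW f g _ c hc hx).add
      (isRationalClass_smul_complexGysin_map μ hS hW f g' _ c hc hx)

end Summit.HodgeConjecture.HodgeConjecture.Theorems.NikulinTwinTransport

end
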